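import Mathlib.Analysis.InnerProductSpace.l2Space
import HarnessLib

/-!
# Coordinatewise convergence in a Hilbert basis plus a `limsup` bound on the norms is norm convergence

Layer `Literature/Analysis/InnerProduct` (everything proved; no definitions, no named facts).  In a real Hilbert space `E`
with a Hilbert basis `(bᵢ)`, a net `yₐ` converges in norm to `z` as soon as every coordinate converges,
`⟪bᵢ, yₐ⟫ → ⟪bᵢ, z⟫`, and `limsup ‖yₐ‖ ≤ ‖z‖` (here: for every `δ > 0` eventually `‖yₐ‖² ≤ ‖z‖² + δ`).  This is the
elementary half of the Radon–Riesz (Kadec–Klee) property of Hilbert spaces — weak convergence and convergence of the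
norms give norm convergence (F. Riesz, B. Sz.-Nagy, *Functional Analysis* (1955), §38; H. Brezis, *Functional Analysis,
Sobolev Spaces and PDE* (2011), Prop. 3.32) — in the form where weak convergence is only tested on a Hilbert basis, which
suffices because the norms are eventually bounded: expand `‖yₐ − z‖² = ‖yₐ‖² − 2⟪yₐ, z⟫ + ‖z‖²` and approximate `z` by a
finite truncation `z_G = ∑_{i ∈ G} ⟪bᵢ, z⟫ bᵢ` (`HilbertBasis.hasSum_repr`), on which the pairing converges
(`tendsto_of_forall_inner_hilbertBasis_tendsto`).

Mathlib search (`HilbertBasis`, `Kadec`, `Radon-Riesz`, `tendsto_of_tendsto_norm`): Mathlib has `HilbertBasis.hasSum_repr`,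
`HilbertBasis.hasSum_inner_mul_inner`, but no weak-plus-norm ⇒ strong convergence statement for Hilbert spaces.

## References

* H. Brezis, *Functional Analysis, Sobolev Spaces and Partial Differential Equations*, Springer (2011), Prop. 3.32.
  [Brezis2011]
* F. Riesz, B. Sz.-Nagy, *Functional Analysis*, Ungar (1955), §38.
-/

open Filter
open scoped InnerProductSpace Topology

namespace Literature.Analysis.InnerProduct

/-- **Coordinatewise convergence plus a `limsup` bound on the norms is norm convergence** (the Radon–Riesz property of
Hilbert spaces, tested on a Hilbert basis; Brezis 2011, Prop. 3.32).  In a real Hilbert space with a Hilbert basis `b`,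
if `⟪b i, yₐ⟫ → ⟪b i, z⟫` for every `i` and for every `δ > 0` eventually `‖yₐ‖² ≤ ‖z‖² + δ`, then `yₐ → z`: expand
`‖yₐ − z‖² = ‖yₐ‖² − 2⟪yₐ, z⟫ + ‖z‖²` and approximate `z` by a finite truncation in the basis, on which the pairing
converges. [cite: Brezis2011, Prop. 3.32] -/
theorem tendsto_of_forall_inner_hilbertBasis_tendsto {ι E α : Type*} [NormedAddCommGroup E] [InnerProductSpace ℝ E]
    [CompleteSpace E] (b : HilbertBasis ι ℝ E) {l : Filter α} {y : α → E} {z : E}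
    (hcoord : ∀ i, Tendsto (fun a => ⟪b i, y a⟫_ℝ) l (𝓝 ⟪b i, z⟫_ℝ))
    (hnorm : ∀ δ : ℝ, 0 < δ → ∀ᶠ a in l, ‖y a‖ ^ 2 ≤ ‖z‖ ^ 2 + δ) : Tendsto y l (𝓝 z) := by
  rw [Metric.tendsto_nhds]
  intro ε hε
  set M : ℝ := ‖z‖ + 1 with hM
  have hM0 : 0 < M := by positivity
  set η : ℝ := ε ^ 2 / (16 * M) with hη
  have hη0 : 0 < η := by positivity
  -- a finite truncation of `z`
  obtain ⟨G, hG⟩ : ∃ G : Finset ι, dist (∑ i ∈ G, b.repr z i • b i) z < η :=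
    ((b.hasSum_repr z).eventually (Metric.ball_mem_nhds z hη0)).exists
  set zG : E := ∑ i ∈ G, b.repr z i • b i with hzG
  have hzG' : ‖z - zG‖ < η := by rwa [dist_eq_norm, norm_sub_rev] at hG
  -- the pairing with the truncation converges
  have h2 : Tendsto (fun a => ⟪y a, zG⟫_ℝ) l (𝓝 ⟪z, zG⟫_ℝ) := by
    have he : ∀ x : E, ⟪x, zG⟫_ℝ = ∑ i ∈ G, b.repr z i * ⟪b i, x⟫_ℝ := fun x => by
      rw [hzG, inner_sum]
      refine Finset.sum_congr rfl fun i _ => ?_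
      rw [real_inner_smul_right, real_inner_comm]
    simp only [he]
    exact tendsto_finsetSum _ fun i _ => (hcoord i).const_mul _
  have h2' : ∀ᶠ a in l, ⟪z, zG⟫_ℝ - η < ⟪y a, zG⟫_ℝ :=
    h2.eventually (Ioi_mem_nhds (sub_lt_self _ hη0))
  have h1 : ∀ᶠ a in l, ‖y a‖ ^ 2 ≤ ‖z‖ ^ 2 + min 1 (ε ^ 2 / 2) := hnorm _ (lt_min one_pos (by positivity))
  filter_upwards [h1, h2'] with a ha ha2
  -- `‖y a‖ ≤ M`
  have hya : ‖y a‖ ≤ M := by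
    have h3 : ‖y a‖ ^ 2 ≤ M ^ 2 := by
      have : ‖y a‖ ^ 2 ≤ ‖z‖ ^ 2 + 1 := ha.trans (by linarith [min_le_left (1 : ℝ) (ε ^ 2 / 2)])
      nlinarith [norm_nonneg z]
    exact (abs_le_of_sq_le_sq' h3 hM0.le).2
  -- lower bound for `⟪y a, z⟫`
  have hin : ‖z‖ ^ 2 - ‖z‖ * η - η - M * η ≤ ⟪y a, z⟫_ℝ := by
    have e1 : ⟪y a, z⟫_ℝ = ⟪y a, zG⟫_ℝ + ⟪y a, z - zG⟫_ℝ := by rw [← inner_add_right, add_sub_cancel]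
    have e2 : ⟪z, zG⟫_ℝ = ‖z‖ ^ 2 - ⟪z, z - zG⟫_ℝ := by
      rw [inner_sub_right, real_inner_self_eq_norm_sq]; ring
    have b1 : |⟪y a, z - zG⟫_ℝ| ≤ M * η :=
      (abs_real_inner_le_norm _ _).trans (mul_le_mul hya hzG'.le (norm_nonneg _) hM0.le)
    have b2 : |⟪z, z - zG⟫_ℝ| ≤ ‖z‖ * η :=
      (abs_real_inner_le_norm _ _).trans (mul_le_mul_of_nonneg_left hzG'.le (norm_nonneg _))
    rw [e1]
    rw [e2] at ha2
    linarith [(abs_le.1 b1).1, (abs_le.1 b2).2]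
  -- conclusion
  have hsq : ‖y a - z‖ ^ 2 < ε ^ 2 := by
    have e : ‖y a - z‖ ^ 2 = ‖y a‖ ^ 2 - 2 * ⟪y a, z⟫_ℝ + ‖z‖ ^ 2 := norm_sub_sq_real _ _
    have hε2 : ‖y a‖ ^ 2 ≤ ‖z‖ ^ 2 + ε ^ 2 / 2 := ha.trans (by linarith [min_le_right (1 : ℝ) (ε ^ 2 / 2)])
    have hMη : 16 * M * η = ε ^ 2 := by rw [hη]; field_simp
    nlinarith [norm_nonneg z, hM0, hη0]
  rw [dist_eq_norm]
  exact lt_of_pow_lt_pow_left₀ 2 hε.le hsq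

end Literature.Analysis.InnerProduct
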